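import Mathlib
import Literature.Analysis.FluidPDE.ClassicalSolution
import Literature.Analysis.FluidPDE.VectorCalculus
import HarnessLib

/-!
# Route `GaldiLiouvilleGate`, crux `RecordZoomAncient` (stmt-NavierStokesRegularity-0894),
  line `registered` (birth skeleton, reshape r2) — stub `stub_typeIBranch`
  (the Type-I-enstrophy branch of the concentration step)

**Statement.** Pure bookkeeping over three inputs supplied by the composition
`RecordZoomAncient_of`. Write `E(s) = ∫⁻ |∇u(s)|²` (an extended nonnegative real). The inputs are
(i) Leray's rate: at every `t ∈ [0, T)` some point `x` has `‖u(t, x)‖ ≥ c_L √ν / √(T − t)`;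
(ii) persistence of the enstrophy: `E(t₀) ≤ L ⇒ E(t) ≤ K L` for `t ∈ [t₀, T)` with
`t − t₀ ≤ c_P ν³ / L²`; (iii) Type-I enstrophy along a sequence: for every `t' < T` there is
`t ∈ [t', T)` with `E(s) ≤ L₀(t) := C ν √ν / √(T − t)` for all `s ∈ [0, t]`. The output: base
times `tc n ∈ (0, T)`, centres `xc n`, levels `L n > 0` dominating `E` on `[0, tc n]`, a fixed
rescaled time `s₀ < 0` and a `θ > 0` with `tc n · (L n)² → ∞` and
`θ ≤ ‖(ν / L n) • u (tc n + ν³ s₀ / (L n)²) (xc n)‖`.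

**Proof.** Put `a := min c_P C²`, `s₀ := −a K² / 2`, `θ := c_L / (K C)`. Along the probing
times `t'ₙ := T − T/(n+2)` choose by (iii) times `tₙ ∈ [t'ₙ, T)` with `E ≤ L₀ₙ := C ν√ν/√(T − tₙ)`
on `[0, tₙ]`, and by (i) points `xₙ` with `‖u(tₙ, xₙ)‖ ≥ c_L √ν/√(T − tₙ)`. Set `L n := K L₀ₙ`,
`xc n := xₙ`, `tc n := tₙ + (a/2)(T − tₙ)/C²`. Since `ν³ / L₀ₙ² = (T − tₙ)/C²`
(`(ν√ν)² = ν³`), the rescaled time `s₀` of the zoom based at `tc n` is the original time `tₙ`,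
where `(ν / L n) · c_L √ν/√(T − tₙ) = c_L/(K C) = θ`; `tc n < T` because `a ≤ C²`; the level
`L n` dominates `E` on `[0, tₙ]` by (iii) (`K ≥ 1`) and on `[tₙ, tc n]` by (ii) (`a ≤ c_P`);
finally `tc n ≥ T/2` and `(L n)² = K² C² ν³/(T − tₙ) ≥ K² C² ν³ (n+2)/T`, so
`tc n · (L n)² ≥ K² C² ν³ (n+2)/2 → ∞`. Elementary real arithmetic (Mathlib only).
-/

noncomputable section

open Set MeasureTheory Filter Topology Function
open scoped ENNReal NNReal
open Literature.Analysis.FluidPDE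

namespace Summit.NavierStokesRegularity.NavierStokesRegularity.Theorems.RecordZoomAncient.Birth

-- the problem-side namespace `Summit.NavierStokesRegularity.NavierStokesRegularity.…` (summit =
-- problem for this single-problem summit) duplicates `NavierStokesRegularity` by design
set_option linter.dupNamespace false

/-- Square of the Type-I level: `(C ν √ν / √d)² = C² ν³ / d` for `ν, d ≥ 0`. -/
private theorem level_sq {ν C d : ℝ} (hν : 0 ≤ ν) (hd : 0 ≤ d) :
    (C * (ν * Real.sqrt ν) / Real.sqrt d) ^ 2 = C ^ 2 * ν ^ 3 / d := by
  rw [div_pow, mul_pow, mul_pow, Real.sq_sqrt hν, Real.sq_sqrt hd]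
  ring

/-- The critical time unit of the level `C ν √ν / √d` is `d / C²`:
`ν³ / (C ν √ν / √d)² = d / C²` (`ν, C, d > 0`). -/
private theorem crit_unit {ν C d : ℝ} (hν : 0 < ν) (hC : 0 < C) (hd : 0 < d) :
    ν ^ 3 / (C * (ν * Real.sqrt ν) / Real.sqrt d) ^ 2 = d / C ^ 2 := by
  rw [level_sq hν.le hd.le]
  field_simp

/-- The critical time unit of the level `K · (C ν √ν / √d)` is `d / (K² C²)`. -/
private theorem crit_unit_mul {ν K C d : ℝ} (hν : 0 < ν) (hK : 0 < K) (hC : 0 < C)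
    (hd : 0 < d) :
    ν ^ 3 / (K * (C * (ν * Real.sqrt ν) / Real.sqrt d)) ^ 2 = d / (K ^ 2 * C ^ 2) := by
  rw [mul_pow, level_sq hν.le hd.le]
  field_simp

/-- At the velocity scale `ν / (K L₀)`, `L₀ = C ν √ν / √d`, Leray's rate `c_L √ν / √d` reads
`c_L / (K C)`. -/
private theorem velocity_scale {ν K C d cL : ℝ} (hν : 0 < ν) (hK : 0 < K) (hC : 0 < C)
    (hd : 0 < d) :
    ν / (K * (C * (ν * Real.sqrt ν) / Real.sqrt d)) * (cL * Real.sqrt ν / Real.sqrt d) =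
      cL / (K * C) := by
  have hsν : 0 < Real.sqrt ν := Real.sqrt_pos.mpr hν
  have hsd : 0 < Real.sqrt d := Real.sqrt_pos.mpr hd
  field_simp

/-- The probing times `T − T/(n+2)` lie in `[0, T)`, and `T/(n+2) ≤ T/2`. -/
private theorem probe_mem {T : ℝ} (hT : 0 < T) (n : ℕ) :
    T - T / ((n : ℝ) + 2) ∈ Ico 0 T ∧ T / ((n : ℝ) + 2) ≤ T / 2 := by
  have hn : (0 : ℝ) < (n : ℝ) + 2 := by positivity
  have hle : T / ((n : ℝ) + 2) ≤ T / 2 :=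
    div_le_div_of_nonneg_left hT.le two_pos (by linarith [n.cast_nonneg (α := ℝ)])
  exact ⟨⟨by linarith [half_le_self hT.le], sub_lt_self _ (div_pos hT hn)⟩, hle⟩

/-- **stub 2a — `stub_typeIBranch` (the Type-I-enstrophy branch of the concentration step;
pure bookkeeping).** Inputs, all supplied by the composition: (i) Leray's lower bound on the
maximum velocity before the blow-up time, `‖u(t, x)‖ ≥ c_L √ν/√(T−t)` for some `x`, at every
`t ∈ [0, T)`; (ii) the persistence bound of the enstrophy (constants `c_P > 0`, `K ≥ 1`);
(iii) the Type-I-enstrophy hypothesis along a sequence: for some `C > 0`, arbitrarily close to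
`T` there are times `t` with `∫ |∇u(s)|² ≤ C ν^{3/2}/√(T−t)` for all `s ∈ [0, t]`. Then the
enstrophy-normalised zooms are concentrated: with `L₀ = C ν^{3/2}/√(T−t)`, level `L = K L₀`,
base time `tc = t + |s₀| ν³/L²` (`|s₀| = min(c_P, C²) K²/2`, so that `tc < T` and persistence
dominates `E` by `L` on `[t, tc]`), the velocity at the rescaled time `s₀` (i.e. at the original
time `t`) and the centre `xc = x` of (i) has `‖(ν/L) u(t, x)‖ ≥ c_L/(K C) =: θ`; along
`t'ₙ = T − T/(n+2)` the products `tc · L²` tend to `∞`. -/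
theorem stub_typeIBranch :
    ∀ (ν T : ℝ), 0 < ν → 0 < T →
      ∀ (u : ℝ → EuclideanSpace ℝ (Fin 3) → EuclideanSpace ℝ (Fin 3))
        (p : ℝ → EuclideanSpace ℝ (Fin 3) → ℝ),
        IsClassicalNSSolutionOn (Set.Ico 0 T) ν 0 u p →
        ∀ cL : ℝ, 0 < cL →
          (∀ t ∈ Set.Ico 0 T, ∃ x, cL * Real.sqrt ν / Real.sqrt (T - t) ≤ ‖u t x‖) →
        ∀ cP K : ℝ, 0 < cP → 1 ≤ K →
          (∀ t₀ ∈ Set.Ico 0 T, ∀ L : ℝ, 0 < L →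
            (∫⁻ x, ENNReal.ofReal (frobeniusNormSq (fderiv ℝ (u t₀) x))) ≤ ENNReal.ofReal L →
            ∀ t ∈ Set.Ico t₀ T, t - t₀ ≤ cP * ν ^ 3 / L ^ 2 →
              (∫⁻ x, ENNReal.ofReal (frobeniusNormSq (fderiv ℝ (u t) x))) ≤
                ENNReal.ofReal (K * L)) →
        ∀ C : ℝ, 0 < C →
          (∀ t' ∈ Set.Ico 0 T, ∃ t ∈ Set.Ico t' T, ∀ s ∈ Set.Icc 0 t,
            (∫⁻ x, ENNReal.ofReal (frobeniusNormSq (fderiv ℝ (u s) x))) ≤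
              ENNReal.ofReal (C * (ν * Real.sqrt ν) / Real.sqrt (T - t))) →
        ∃ (tc : ℕ → ℝ) (xc : ℕ → EuclideanSpace ℝ (Fin 3)) (L : ℕ → ℝ) (s₀ θ : ℝ),
          s₀ < 0 ∧ 0 < θ ∧ (∀ n, 0 < tc n ∧ tc n < T) ∧ (∀ n, 0 < L n) ∧
          (∀ n, ∀ t ∈ Set.Icc 0 (tc n),
            ∫⁻ x, ENNReal.ofReal (frobeniusNormSq (fderiv ℝ (u t) x)) ≤ ENNReal.ofReal (L n)) ∧
          Tendsto (fun n => tc n * L n ^ 2) atTop atTop ∧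
          (∀ n, θ ≤ ‖(ν / L n) • u (tc n + ν ^ 3 / L n ^ 2 * s₀) (xc n)‖) := by
  intro ν T hν hT u _p _hsol cL hcL hrate cP K hcP hK hpers C hC hI
  have hK0 : 0 < K := one_pos.trans_le hK
  have hsν : 0 < Real.sqrt ν := Real.sqrt_pos.mpr hν
  -- the parameter `a = min c_P C²`
  obtain ⟨a, ha, haP, haC⟩ : ∃ a : ℝ, 0 < a ∧ a ≤ cP ∧ a ≤ C ^ 2 :=
    ⟨min cP (C ^ 2), lt_min hcP (by positivity), min_le_left _ _, min_le_right _ _⟩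
  -- Type-I times `tₙ ∈ [T − T/(n+2), T)` with domination by `L₀ₙ` on `[0, tₙ]` (input (iii))
  choose t ht hdomI using fun n : ℕ => hI (T - T / ((n : ℝ) + 2)) (probe_mem hT n).1
  have ht0 : ∀ n, 0 ≤ t n := fun n => (probe_mem hT n).1.1.trans (ht n).1
  have htT : ∀ n, t n < T := fun n => (ht n).2
  have hd : ∀ n, 0 < T - t n := fun n => sub_pos.mpr (htT n)
  have hT2 : ∀ n, T / 2 ≤ t n := fun n => by
    have h1 := (probe_mem hT n).2
    have h2 := (ht n).1
    linarith
  -- Leray points `xₙ` at the times `tₙ` (input (i))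
  choose x hx using fun n : ℕ => hrate (t n) ⟨ht0 n, htT n⟩
  -- the Type-I levels `L₀ₙ = C ν√ν / √(T − tₙ)`
  obtain ⟨L₀, hL₀_def⟩ :
      ∃ L₀ : ℕ → ℝ, ∀ n, L₀ n = C * (ν * Real.sqrt ν) / Real.sqrt (T - t n) :=
    ⟨_, fun n => rfl⟩
  have hL₀ : ∀ n, 0 < L₀ n := fun n => by
    rw [hL₀_def]
    exact div_pos (mul_pos hC (mul_pos hν hsν)) (Real.sqrt_pos.mpr (hd n))
  have hdomI' : ∀ n, ∀ s ∈ Icc 0 (t n),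
      (∫⁻ y, ENNReal.ofReal (frobeniusNormSq (fderiv ℝ (u s) y))) ≤ ENNReal.ofReal (L₀ n) :=
    fun n s hs => by rw [hL₀_def]; exact hdomI n s hs
  -- base times `tc n = tₙ + (a/2)(T − tₙ)/C²`
  obtain ⟨tc, htc_def⟩ : ∃ tc : ℕ → ℝ, ∀ n, tc n = t n + a / 2 * (T - t n) / C ^ 2 :=
    ⟨_, fun n => rfl⟩
  have hδ : ∀ n, 0 < a / 2 * (T - t n) / C ^ 2 := fun n => by
    have hdn := hd n
    positivity
  have hδlt : ∀ n, a / 2 * (T - t n) / C ^ 2 < T - t n := fun n => by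
    have hdn := hd n
    calc a / 2 * (T - t n) / C ^ 2 ≤ C ^ 2 / 2 * (T - t n) / C ^ 2 := by gcongr
      _ = (T - t n) / 2 := by field_simp
      _ < T - t n := half_lt_self hdn
  have htc : ∀ n, 0 < tc n ∧ tc n < T := fun n => by
    rw [htc_def]
    exact ⟨(ht0 n).trans_lt (lt_add_of_pos_right _ (hδ n)), by linarith [hδlt n]⟩
  have htc_ge : ∀ n, t n ≤ tc n := fun n => by rw [htc_def]; linarith [hδ n]
  -- the critical time unit of the level `K L₀ₙ` and the rescaled time `s₀`
  have hunit : ∀ n, ν ^ 3 / (K * L₀ n) ^ 2 = (T - t n) / (K ^ 2 * C ^ 2) := fun n => by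
    rw [hL₀_def]; exact crit_unit_mul hν hK0 hC (hd n)
  have htime : ∀ n, tc n + ν ^ 3 / (K * L₀ n) ^ 2 * -(a * K ^ 2 / 2) = t n := fun n => by
    rw [hunit, htc_def]
    field_simp
    ring
  -- `s₀ < 0`
  have hs₀ : -(a * K ^ 2 / 2) < 0 := by
    have : 0 < a * K ^ 2 / 2 := by positivity
    linarith
  -- domination of the enstrophy by `K L₀ₙ` on `[0, tc n]`
  have hdom : ∀ n, ∀ s ∈ Icc 0 (tc n),
      (∫⁻ y, ENNReal.ofReal (frobeniusNormSq (fderiv ℝ (u s) y))) ≤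
        ENNReal.ofReal (K * L₀ n) := by
    intro n s hs
    rcases le_or_gt s (t n) with hle | hlt
    · -- on `[0, tₙ]`: input (iii) and `K ≥ 1`
      exact (hdomI' n s ⟨hs.1, hle⟩).trans
        (ENNReal.ofReal_le_ofReal (le_mul_of_one_le_left (hL₀ n).le hK))
    · -- on `(tₙ, tc n]`: persistence (input (ii)) from the level `L₀ₙ` at `tₙ`
      have hdn := hd n
      refine hpers (t n) ⟨ht0 n, htT n⟩ (L₀ n) (hL₀ n) (hdomI' n (t n) ⟨ht0 n, le_rfl⟩) s
        ⟨hlt.le, hs.2.trans_lt (htc n).2⟩ ?_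
      calc s - t n ≤ a / 2 * (T - t n) / C ^ 2 := by linarith [hs.2, htc_def n]
        _ ≤ cP * (T - t n) / C ^ 2 := by gcongr; linarith
        _ = cP * (ν ^ 3 / L₀ n ^ 2) := by rw [hL₀_def, crit_unit hν hC hdn, mul_div_assoc]
        _ = cP * ν ^ 3 / L₀ n ^ 2 := (mul_div_assoc _ _ _).symm
  -- `tc n · (L n)² → ∞`
  have htend : Tendsto (fun n => tc n * (K * L₀ n) ^ 2) atTop atTop := by
    have hc : 0 < K ^ 2 * C ^ 2 * ν ^ 3 / 2 := by positivity
    refine tendsto_atTop_mono (f := fun n : ℕ => K ^ 2 * C ^ 2 * ν ^ 3 / 2 * ((n : ℝ) + 2))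
      (fun n => ?_) ?_
    · have hdn := hd n
      have htcn : T / 2 ≤ tc n := (hT2 n).trans (htc_ge n)
      have hn : (0 : ℝ) < (n : ℝ) + 2 := by positivity
      have hsq : (K * L₀ n) ^ 2 = K ^ 2 * (C ^ 2 * ν ^ 3 / (T - t n)) := by
        rw [mul_pow, hL₀_def, level_sq hν.le hdn.le]
      have hlev : K ^ 2 * (C ^ 2 * ν ^ 3 / (T / ((n : ℝ) + 2))) ≤ (K * L₀ n) ^ 2 := by
        rw [hsq]
        gcongr
        linarith [(ht n).1]
      calc K ^ 2 * C ^ 2 * ν ^ 3 / 2 * ((n : ℝ) + 2)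
          = T / 2 * (K ^ 2 * (C ^ 2 * ν ^ 3 / (T / ((n : ℝ) + 2)))) := by
            field_simp
        _ ≤ tc n * (K * L₀ n) ^ 2 :=
            mul_le_mul htcn hlev (by positivity) ((half_pos hT).le.trans htcn)
    · exact Tendsto.const_mul_atTop hc
        (tendsto_atTop_add_const_right _ _ tendsto_natCast_atTop_atTop)
  -- the velocity at the rescaled time `s₀` (original time `tₙ`) and the centre `xₙ`
  have hvel : ∀ n, cL / (K * C) ≤
      ‖(ν / (K * L₀ n)) • u (tc n + ν ^ 3 / (K * L₀ n) ^ 2 * -(a * K ^ 2 / 2)) (x n)‖ := by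
    intro n
    have hdn := hd n
    have hscale : ν / (K * L₀ n) * (cL * Real.sqrt ν / Real.sqrt (T - t n)) = cL / (K * C) := by
      rw [hL₀_def]; exact velocity_scale hν hK0 hC hdn
    have hcoef : 0 ≤ ν / (K * L₀ n) := (div_pos hν (mul_pos hK0 (hL₀ n))).le
    rw [htime n, norm_smul, Real.norm_of_nonneg hcoef, ← hscale]
    exact mul_le_mul_of_nonneg_left (hx n) hcoef
  exact ⟨tc, x, fun n => K * L₀ n, -(a * K ^ 2 / 2), cL / (K * C), hs₀, by positivity, htc,
    fun n => mul_pos hK0 (hL₀ n), hdom, htend, hvel⟩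

end Summit.NavierStokesRegularity.NavierStokesRegularity.Theorems.RecordZoomAncient.Birth

end
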